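import Summits.CriticalPhenomena.CardyFormulaZ2.Theses.CardyBoundaryCoulombGas
import Literature.Probability.Percolation.CornerPercolation
import Literature.Probability.Percolation.LatticeSymmetry

/-!
# `HalfPlaneMarkDensityLaw` (crux stmt-CriticalPhenomena-5661, route CardyBoundaryCoulombGas):
# read-back, the exact Russo/telescoping identity and translation covariance (negative-side support, 1/4)

Support file of the crux disprover (cdisprove seat, 2026-08-16); `sorry`-free, standard axioms.

The crux, literally (`halfPlaneMarkDensityLaw_iff`): for all reals `a < b < c < x`,
`n · P_{1/2}[E_n(a,b,c,x)] → density a b c x` where, in the lattice half-plane `H = ℤ × ℕ` of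
bond-`ℤ²`, `E_n = {A_n ↔ (⌊xn⌋,0) in H} \ {A_n ↔ C_n in H}`, `A_n = [⌊an⌋,⌊bn⌋] × {0}`,
`C_n = [⌊cn⌋,⌊xn⌋) × {0}` ("`⌊xn⌋` is the `c`-most boundary vertex of `[⌊cn⌋,∞)` joined to `A_n`";
zero-length open paths count), `density a b c x = (cardyConst/3)·((b−a)(c−b)(c−a))^{1/3}·((x−a)(x−b)(x−c))^{−2/3}`.

* §0 vocabulary (`halfPlane`, `arcA`, `arcC`, `pt`, `markEvent`, `density`, `μ = P_{1/2}`, `lawSeq`)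
  and `halfPlaneMarkDensityLaw_iff` (`Iff.rfl`).
* §2 EXACT LATTICE IDENTITY (Russo's formula in the position of the fourth mark, no error term):
  with `E(k) = {A ↔ (k,0) in S} \ {A ↔ [k₀,k)×{0} in S}` (`firstHit`; the crux's event is
  `E(⌊xn⌋)` with `k₀ = ⌊cn⌋`, `markEvent_eq_firstHit`), `{A ↔ [k₀,k]×{0}} = {A ↔ [k₀,k−1]×{0}} ⊔ E(k)`,
  hence `P[A ↔ [k₀,k₀+m]×{0} in S] = Σ_{i≤m} P[E(k₀+i)]` (`measure_openCrossing_rowIcc`) for ANY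
  domain and source arc, all partial sums `≤ 1`, and `measure_crossing_eq_sum_markEvents`.
* §5 TRANSLATION COVARIANCE: `measureReal_markEvent_succ_site` —
  `P[E_n(a,b,c; site ⌊xn⌋+1)] = P[E_n(a−1/n,b−1/n,c−1/n; site ⌊xn⌋)]`: the `k`-dependence of the
  lattice density at fixed arcs IS its dependence on the macroscopic marks at resolution `1/n`
  (translation invariance of `P_{1/2}`, tree `real_openCrossing_shift`); a lattice-scale oscillation in
  `k` would be an `O(1)` response of `n·P[E_n]` to moving an arc endpoint by one vertex.
Companion files: `CardyContent` (the constant; crux ⇒ liminf half-plane Cardy), `OrderHypotheses`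
(load-bearing order hypotheses, the substantive case `x = c`), `NoUniformity`.
-/

noncomputable section

namespace Summit.CriticalPhenomena.CardyFormulaZ2.Theorems.HalfPlaneMarkDensityLaw.Negative

open Literature.Probability.Percolation Literature.Probability.LatticeModels
open Literature.Probability.RandomPlanarGeometry
open MeasureTheory Filter Set
open scoped ENNReal NNReal Topology
open Summit.CriticalPhenomena.CardyFormulaZ2.Theses.CardyBoundaryCoulombGas (HalfPlaneMarkDensityLaw)

/-! ## §0 Vocabulary and read-back -/

/-- The lattice upper half-plane `ℤ × ℕ ⊂ ℤ²` (boundary row included), as in the crux. [folklore] -/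
def halfPlane : Set (Site 2) := {v | 0 ≤ v 1}

/-- The boundary arc `A_n = {(k,0) : ⌊an⌋ ≤ k ≤ ⌊bn⌋}` of the crux. [folklore] -/
def arcA (a b : ℝ) (n : ℕ) : Set (Site 2) := {v | v 1 = 0 ∧ ⌊a * n⌋ ≤ v 0 ∧ v 0 ≤ ⌊b * n⌋}

/-- The excluded boundary arc `C_n = {(k,0) : ⌊cn⌋ ≤ k < ⌊xn⌋}` of the crux. [folklore] -/
def arcC (c x : ℝ) (n : ℕ) : Set (Site 2) := {v | v 1 = 0 ∧ ⌊c * n⌋ ≤ v 0 ∧ v 0 < ⌊x * n⌋}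

/-- The marked boundary vertex `(⌊xn⌋, 0)`. [folklore] -/
def pt (x : ℝ) (n : ℕ) : Site 2 := ![⌊x * n⌋, 0]

/-- The crux's event `E_n(a,b,c,x)`: `(⌊xn⌋,0)` is joined to `A_n` inside the half-plane and no vertex
of `C_n` is, i.e. `⌊xn⌋` is the `c`-most vertex of `[⌊cn⌋, ∞)` joined to `A_n`. [folklore] -/
def markEvent (a b c x : ℝ) (n : ℕ) : Set (BondConfig (Site 2)) :=
  openCrossing halfPlane (arcA a b n) {pt x n} \ openCrossing halfPlane (arcA a b n) (arcC c x n)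

/-- The claimed limit density `(cardyConst/3)·Δ^{1/3}·((x−a)(x−b)(x−c))^{−2/3}`. [folklore] -/
def density (a b c x : ℝ) : ℝ :=
  cardyConst / 3 * ((b - a) * (c - b) * (c - a)) ^ (1 / 3 : ℝ) * ((x - a) * (x - b) * (x - c)) ^ (-(2 / 3) : ℝ)

/-- Critical bond percolation on `ℤ²`. [folklore] -/
def μ : Measure (BondConfig (Site 2)) := bondPercolation (zdGraph 2) half

/-- `P_{1/2}` is a probability measure. [folklore] -/
instance : IsProbabilityMeasure μ := by unfold μ; infer_instance

/-- The crux's sequence `n ↦ n · P_{1/2}[E_n(a,b,c,x)]`. [folklore] -/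
def lawSeq (a b c x : ℝ) : ℕ → ℝ := fun n ↦ (n : ℝ) * μ.real (markEvent a b c x n)

/-- The crux is literally `∀ a b c x, a < b → b < c → c < x → lawSeq a b c x → density a b c x`. [folklore] -/
theorem halfPlaneMarkDensityLaw_iff :
    HalfPlaneMarkDensityLaw ↔ ∀ a b c x : ℝ, a < b → b < c → c < x →
      Tendsto (lawSeq a b c x) atTop (𝓝 (density a b c x)) := Iff.rfl

/-- First coordinate of the marked vertex. [folklore] -/
@[simp] lemma pt_zero (x : ℝ) (n : ℕ) : pt x n 0 = ⌊x * n⌋ := rfl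

/-- Second coordinate of the marked vertex. [folklore] -/
@[simp] lemma pt_one (x : ℝ) (n : ℕ) : pt x n 1 = 0 := rfl

/-- The marked vertex lies in the half-plane. [folklore] -/
lemma pt_mem_halfPlane (x : ℝ) (n : ℕ) : pt x n ∈ halfPlane := by
  simp [halfPlane]

/-- Reflexivity: a vertex of `S` is joined to itself inside `S`. [folklore] -/
lemma mem_openConnIn_self {S : Set (Site 2)} {v : Site 2} (hv : v ∈ S) (ω : BondConfig (Site 2)) :
    ω ∈ openConnIn S v v :=
  ⟨hv, hv, SimpleGraph.Reachable.refl _⟩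

/-- If the two arcs share a vertex of `S`, the crossing event is sure. [folklore] -/
lemma openCrossing_eq_univ_of_mem {S A B : Set (Site 2)} {v : Site 2} (hS : v ∈ S) (hA : v ∈ A)
    (hB : v ∈ B) : openCrossing S A B = univ :=
  eq_univ_of_forall fun ω ↦ ⟨v, hA, v, hB, mem_openConnIn_self hS ω⟩

/-- An empty source arc gives the impossible event. [folklore] -/
lemma openCrossing_empty_left (S B : Set (Site 2)) : openCrossing S (∅ : Set (Site 2)) B = ∅ := by
  ext ω; simp [openCrossing]

/-- An empty target arc gives the impossible event. [folklore] -/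
lemma openCrossing_empty_right (S A : Set (Site 2)) : openCrossing S A (∅ : Set (Site 2)) = ∅ := by
  ext ω; simp [openCrossing]

/-! ## §2 Exact lattice identities: the mark events partition the crossing event

For ANY domain `S` and source arc `A`: with `B_k = [k₀,k] × {0}` and
`E(k) = {A ↔ (k,0) in S} \ {A ↔ [k₀,k) × {0} in S}` (the crux's event is `E(⌊xn⌋)` with
`k₀ = ⌊cn⌋`, `markEvent_eq_firstHit`), one has `{A ↔ B_k} = {A ↔ B_{k−1}} ⊔ E(k)`, hence
`P[A ↔ B_{k₀+m}] = Σ_{i ≤ m} P[E(k₀+i)]` (`measure_openCrossing_rowIcc`) and all partial sums are `≤ 1`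
(`sum_firstHit_le_one`): the lattice density telescopes EXACTLY to the lattice crossing probability —
Russo's formula in the position of the fourth mark, with no error term. -/

/-- The boundary segment `[k₀,k₁] × {0}`. [folklore] -/
def rowIcc (k₀ k₁ : ℤ) : Set (Site 2) := {v | v 1 = 0 ∧ k₀ ≤ v 0 ∧ v 0 ≤ k₁}

/-- The boundary segment `[k₀,k₁) × {0}`. [folklore] -/
def rowIco (k₀ k₁ : ℤ) : Set (Site 2) := {v | v 1 = 0 ∧ k₀ ≤ v 0 ∧ v 0 < k₁}

/-- The boundary vertex `(k,0)`. [folklore] -/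
def bpt (k : ℤ) : Site 2 := ![k, 0]

/-- `E(k)`: `(k,0)` is the `k₀`-most vertex of `[k₀,∞) × {0}` joined to `A` inside `S`. [folklore] -/
def firstHit (S A : Set (Site 2)) (k₀ k : ℤ) : Set (BondConfig (Site 2)) :=
  openCrossing S A {bpt k} \ openCrossing S A (rowIco k₀ k)

/-- The crux's event is `firstHit` at `k₀ = ⌊cn⌋`, `k = ⌊xn⌋` (definitional). [folklore] -/
theorem markEvent_eq_firstHit (a b c x : ℝ) (n : ℕ) :
    markEvent a b c x n = firstHit halfPlane (arcA a b n) ⌊c * n⌋ ⌊x * n⌋ := rfl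

/-- A site is `(k,0)` iff its coordinates say so. [folklore] -/
lemma site_eq_bpt_iff (v : Site 2) (k : ℤ) : v = bpt k ↔ v 1 = 0 ∧ v 0 = k := by
  constructor
  · rintro rfl; simp [bpt]
  · rintro ⟨h1, h0⟩
    funext i; fin_cases i <;> simp [bpt, h0, h1]

/-- `[k₀,k) = [k₀,k−1]` on the boundary row. [folklore] -/
lemma rowIco_eq_rowIcc (k₀ k : ℤ) : rowIco k₀ k = rowIcc k₀ (k - 1) := by
  ext v; simp only [rowIco, rowIcc, mem_setOf_eq]; omega

/-- Empty boundary segment. [folklore] -/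
lemma rowIcc_eq_empty {k₀ k₁ : ℤ} (h : k₁ < k₀) : rowIcc k₀ k₁ = ∅ := by
  ext v; simp only [rowIcc, mem_setOf_eq, mem_empty_iff_false, iff_false]; omega

/-- `[k₀,k] = [k₀,k−1] ∪ {k}` on the boundary row. [folklore] -/
lemma rowIcc_eq_union {k₀ k : ℤ} (h : k₀ ≤ k) : rowIcc k₀ k = rowIcc k₀ (k - 1) ∪ {bpt k} := by
  ext v
  simp only [rowIcc, mem_setOf_eq, union_singleton, mem_insert_iff, site_eq_bpt_iff]
  omega

/-- Crossing events are additive in the target arc. [folklore] -/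
lemma openCrossing_union_right (S A B B' : Set (Site 2)) :
    openCrossing S A (B ∪ B') = openCrossing S A B ∪ openCrossing S A B' := by
  ext ω
  simp only [mem_openCrossing_iff, mem_union]
  constructor
  · rintro ⟨x, hx, y, hy | hy, h⟩
    · exact Or.inl ⟨x, hx, y, hy, h⟩
    · exact Or.inr ⟨x, hx, y, hy, h⟩
  · rintro (⟨x, hx, y, hy, h⟩ | ⟨x, hx, y, hy, h⟩)
    · exact ⟨x, hx, y, Or.inl hy, h⟩
    · exact ⟨x, hx, y, Or.inr hy, h⟩

/-- One telescoping step: `{A ↔ B_k} = {A ↔ B_{k−1}} ∪ E(k)`. [folklore] -/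
theorem openCrossing_rowIcc_succ (S A : Set (Site 2)) {k₀ k : ℤ} (h : k₀ ≤ k) :
    openCrossing S A (rowIcc k₀ k) = openCrossing S A (rowIcc k₀ (k - 1)) ∪ firstHit S A k₀ k := by
  rw [rowIcc_eq_union h, openCrossing_union_right, firstHit, rowIco_eq_rowIcc, Set.union_sdiff_self]

/-- … and the two pieces are disjoint. [folklore] -/
theorem disjoint_openCrossing_firstHit (S A : Set (Site 2)) (k₀ k : ℤ) :
    Disjoint (openCrossing S A (rowIcc k₀ (k - 1))) (firstHit S A k₀ k) := by
  rw [firstHit, rowIco_eq_rowIcc]; exact disjoint_sdiff_right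

/-- Mark events are measurable (countably many finite open paths). [folklore] -/
theorem measurableSet_firstHit (S A : Set (Site 2)) (k₀ k : ℤ) : MeasurableSet (firstHit S A k₀ k) :=
  (measurableSet_openCrossing_of_countable _ _ _).diff (measurableSet_openCrossing_of_countable _ _ _)

/-- **§2 main (Russo/telescoping, exact)**: `P[A ↔ [k₀, k₀+m] × {0} in S] = Σ_{i=0}^{m} P[E(k₀+i)]`. [folklore] -/
theorem measure_openCrossing_rowIcc (S A : Set (Site 2)) (k₀ : ℤ) (m : ℕ) :
    μ (openCrossing S A (rowIcc k₀ (k₀ + m))) =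
      ∑ i ∈ Finset.range (m + 1), μ (firstHit S A k₀ (k₀ + i)) := by
  induction m with
  | zero =>
    rw [Finset.sum_range_one, Nat.cast_zero, add_zero, openCrossing_rowIcc_succ S A le_rfl,
      rowIcc_eq_empty (by omega), openCrossing_empty_right, empty_union]
  | succ m ih =>
    have hk : k₀ + ((m + 1 : ℕ) : ℤ) - 1 = k₀ + (m : ℤ) := by push_cast; ring
    rw [Finset.sum_range_succ, ← ih, openCrossing_rowIcc_succ S A (k := k₀ + ((m + 1 : ℕ) : ℤ)) (by omega),
      hk, measure_union (by rw [← hk]; exact disjoint_openCrossing_firstHit S A k₀ _)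
        (measurableSet_firstHit S A _ _)]

/-- Corollary: every partial sum of mark-event probabilities is at most `1`. [folklore] -/
theorem sum_firstHit_le_one (S A : Set (Site 2)) (k₀ : ℤ) (m : ℕ) :
    ∑ i ∈ Finset.range (m + 1), μ (firstHit S A k₀ (k₀ + i)) ≤ 1 := by
  rw [← measure_openCrossing_rowIcc]; exact prob_le_one

/-- Corollary for the crux's own events: for `c ≤ x`,
`P[A_n ↔ [⌊cn⌋,⌊xn⌋] × {0} in H] = Σ_{k=⌊cn⌋}^{⌊xn⌋} P[E_n at lattice point k]` where the `k`-th
term is `markEvent` at any real `y` with `⌊yn⌋ = k` — the lattice crossing probability IS the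
Riemann sum of the lattice density. [folklore] -/
theorem measure_crossing_eq_sum_markEvents (a b c x : ℝ) (n : ℕ) (hcx : c ≤ x) :
    μ (openCrossing halfPlane (arcA a b n) (rowIcc ⌊c * n⌋ ⌊x * n⌋)) =
      ∑ i ∈ Finset.range ((⌊x * n⌋ - ⌊c * n⌋).toNat + 1),
        μ (firstHit halfPlane (arcA a b n) ⌊c * n⌋ (⌊c * n⌋ + i)) := by
  have hle : ⌊c * n⌋ ≤ ⌊x * n⌋ := Int.floor_le_floor (by exact mul_le_mul_of_nonneg_right hcx (Nat.cast_nonneg n))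
  have : ⌊x * n⌋ = ⌊c * n⌋ + ((⌊x * n⌋ - ⌊c * n⌋).toNat : ℕ) := by
    rw [Int.toNat_of_nonneg (by omega)]; ring
  conv_lhs => rw [this]
  exact measure_openCrossing_rowIcc _ _ _ _


/-! ## §5 Translation covariance: the next site with the same arcs = the same site with the arcs moved by `−1/n`

The only conceivable failure mode of the crux that does not touch Cardy's formula is a LATTICE-SCALE
OSCILLATION of `k ↦ P[E_n(k)]` at fixed arcs (the planner's kill criterion (d)).  The exact identity
`measureReal_markEvent_succ_site` shows what such an oscillation would have to be: since the lattice
half-plane is invariant under the horizontal unit shift, `P[E_n at site ⌊xn⌋+1; arcs a,b,c] =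
P[E_n at site ⌊xn⌋; arcs a−1/n, b−1/n, c−1/n]`, i.e. the `k`-dependence at fixed arcs IS the
dependence on the macroscopic marks at resolution `1/n`.  An `O(1)` relative oscillation in `k` would
be an `O(1)` sensitivity of `n·P[E_n]` to moving an arc endpoint by ONE vertex, against RSW arm
separation (moving an endpoint of `A_n` or `C_n` by one vertex changes the event only on an extra
boundary arm issued from that vertex, relative cost `n^{-1/3+o(1)}` heuristically; universally
`≤ n^{-δ}` on `ℤ²`).  MC (§7) sees no parity effect at the `10⁻³` level. -/

/-- The horizontal unit vector `e₀ = (1,0)`. [folklore] -/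
def e0 : Site 2 := ![1, 0]

/-- First coordinate of `e₀`. [folklore] -/
@[simp] lemma e0_zero : e0 0 = 1 := rfl

/-- Second coordinate of `e₀`. [folklore] -/
@[simp] lemma e0_one : e0 1 = 0 := rfl

/-- The unit shift of a set of sites as a preimage. [folklore] -/
lemma image_shift_eq_preimage (T : Set (Site 2)) : (· + e0) '' T = {v | v - e0 ∈ T} := by
  ext v
  simp only [mem_image, mem_setOf_eq]
  constructor
  · rintro ⟨w, hw, rfl⟩; simpa using hw
  · intro hv; exact ⟨v - e0, hv, by simp⟩

/-- The lattice half-plane is invariant under the horizontal unit shift. [folklore] -/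
@[simp] lemma image_shift_halfPlane : (· + e0) '' halfPlane = halfPlane := by
  rw [image_shift_eq_preimage]; ext v; simp [halfPlane]

/-- Shifted boundary segments. [folklore] -/
@[simp] lemma image_shift_rowIcc (k₀ k : ℤ) : (· + e0) '' rowIcc k₀ k = rowIcc (k₀ + 1) (k + 1) := by
  rw [image_shift_eq_preimage]; ext v
  simp only [rowIcc, mem_setOf_eq, Pi.sub_apply, e0_one, sub_zero, e0_zero]
  omega

/-- Shifting the arc `A_n` by one vertex = moving both marks by `1/n`. [folklore] -/
lemma image_shift_arcA (a b : ℝ) {n : ℕ} (hn : 0 < n) :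
    (· + e0) '' arcA (a - 1 / n) (b - 1 / n) n = arcA a b n := by
  have hn' : (n : ℝ) ≠ 0 := by exact_mod_cast hn.ne'
  have ha : ⌊(a - 1 / n) * n⌋ = ⌊a * n⌋ - 1 := by
    rw [show (a - 1 / n) * n = a * n - 1 by field_simp, Int.floor_sub_one]
  have hb : ⌊(b - 1 / n) * n⌋ = ⌊b * n⌋ - 1 := by
    rw [show (b - 1 / n) * n = b * n - 1 by field_simp, Int.floor_sub_one]
  rw [image_shift_eq_preimage]; ext v
  simp only [arcA, mem_setOf_eq, Pi.sub_apply, e0_one, sub_zero, e0_zero, ha, hb]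
  omega

/-- Real-valued one-step telescoping (§2): `P[E(k)] = P[A ↔ B_k] − P[A ↔ B_{k−1}]`. [folklore] -/
theorem measureReal_firstHit_eq_sub (S A : Set (Site 2)) {k₀ k : ℤ} (hk : k₀ ≤ k) :
    μ.real (firstHit S A k₀ k) =
      μ.real (openCrossing S A (rowIcc k₀ k)) - μ.real (openCrossing S A (rowIcc k₀ (k - 1))) := by
  rw [openCrossing_rowIcc_succ S A hk, measureReal_union (disjoint_openCrossing_firstHit S A k₀ k)
    (measurableSet_firstHit S A k₀ k)]
  ring

/-- Shifting the source arc and the target window by `e₀` does not change `P[E(k)]`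
(translation invariance of `P_{1/2}` on `ℤ²`, tree `real_openCrossing_shift`, and invariance of the
lattice half-plane under horizontal shifts). [folklore] -/
theorem measureReal_firstHit_shift (A : Set (Site 2)) {k₀ k : ℤ} (hk : k₀ ≤ k) :
    μ.real (firstHit halfPlane ((· + e0) '' A) (k₀ + 1) (k + 1)) = μ.real (firstHit halfPlane A k₀ k) := by
  rw [measureReal_firstHit_eq_sub _ _ (by omega : k₀ + 1 ≤ k + 1), measureReal_firstHit_eq_sub _ _ hk,
    show k + 1 - 1 = (k - 1) + 1 by ring, ← image_shift_rowIcc k₀ k, ← image_shift_rowIcc k₀ (k - 1)]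
  conv_lhs => rw [← image_shift_halfPlane]
  unfold μ
  rw [real_openCrossing_shift, real_openCrossing_shift]

/-- **§5 main**: `P[E_n(a,b,c; site ⌊xn⌋+1)] = P[E_n(a−1/n, b−1/n, c−1/n; site ⌊xn⌋)]` — the next
lattice site with the same arcs is the same site with all three marks moved by `−1/n`. [folklore] -/
theorem measureReal_markEvent_succ_site (a b c x : ℝ) {n : ℕ} (hn : 0 < n) (hcx : c ≤ x) :
    μ.real (markEvent a b c (x + 1 / n) n) = μ.real (markEvent (a - 1 / n) (b - 1 / n) (c - 1 / n) x n) := by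
  have hn' : (n : ℝ) ≠ 0 := by exact_mod_cast hn.ne'
  have hx : ⌊(x + 1 / n) * n⌋ = ⌊x * n⌋ + 1 := by
    rw [show (x + 1 / n) * n = x * n + 1 by field_simp, Int.floor_add_one]
  have hc : ⌊(c - 1 / n) * n⌋ = ⌊c * n⌋ - 1 := by
    rw [show (c - 1 / n) * n = c * n - 1 by field_simp, Int.floor_sub_one]
  have hle : ⌊c * n⌋ ≤ ⌊x * n⌋ :=
    Int.floor_le_floor (mul_le_mul_of_nonneg_right hcx (Nat.cast_nonneg n))
  have h := measureReal_firstHit_shift (arcA (a - 1 / n) (b - 1 / n) n) (k₀ := ⌊c * n⌋ - 1)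
    (k := ⌊x * n⌋) (by omega)
  rw [show ⌊c * (n : ℝ)⌋ - 1 + 1 = ⌊c * (n : ℝ)⌋ by ring] at h
  rw [markEvent_eq_firstHit, markEvent_eq_firstHit, hx, hc, ← image_shift_arcA a b hn]
  exact h

end Summit.CriticalPhenomena.CardyFormulaZ2.Theorems.HalfPlaneMarkDensityLaw.Negative
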